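import Mathlib
import Literature.Probability.LatticeModels.IsingLimitLawTilt
import HarnessLib

/-!
# Stub `stub_chainMarkovPlain` — the nearest-neighbour Ising chain as a transfer product

Plain twin of `Theorems.LeeYangLeeyangThesisStubChainMarkov` (stub `stub_chainMarkov`):
same statement and proof, with the shorthands of that file written out in full and its declarations
renamed `chainMarkov_* ↦ chainMarkovPlain_*`.

Crux `LeeYang.LeeyangThesis` (stmt-RiemannHypothesis-0451), line `Sketch` (card telegraph-string):
the Ising half of the finite dictionary. For step data (`ℓ_j ≥ 0`, `0 < P_0 < P_1 < …`) the
nearest-neighbour chain with weights `w_j = P_j ℓ_j` and bond couplings `K_j ≥ 0`,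
`tanh K_j = P_j / P_{j+1}`, has Laplace transform the `(0,0)` entry of the transfer product
`∏_j !![cosh(h w_j), h P_j sinh(h w_j); sinh(h w_j)/(h P_j), cosh(h w_j)]`.

Proof: transfer-matrix recursion. The chain `0..k` has `k + 1` spins, couplings
`fun i j : Fin (k + 1) => if i.1 + 1 = j.1 then K i else 0` and weights `fun i => P i * ℓ i`
(`K P ℓ : ℕ → ℝ`; written out in full below). With `Z_k(h)` its field partition function and
`B_k(h)` the same Gibbs–Laplace sum weighted by the last spin, peeling off the last spin gives
`Z_{k+1} = 2 (cosh(h w_{k+1}) cosh K_k Z_k + sinh(h w_{k+1}) sinh K_k B_k)` and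
`B_{k+1} = 2 (sinh(h w_{k+1}) cosh K_k Z_k + cosh(h w_{k+1}) sinh K_k B_k)`, whence
`(M_0 ⋯ M_k)₀₀ · c_k = Z_k` and `(M_0 ⋯ M_k)₀₁ · c_k = h P_k B_k` with `c_k` independent of `h`;
at `h = 0` the product is `1` (Lean's `x / 0 = 0`), so `c_k = Z(0)` and `Z(h)/Z(0) = (∏ M_j)₀₀`.
-/

noncomputable section

-- the sub-problem path `RiemannHypothesis/RiemannHypothesis` duplicates a namespace
set_option linter.dupNamespace false

open MeasureTheory Filter Topology Complex
open scoped ENNReal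

namespace Summit.RiemannHypothesis.RiemannHypothesis.Theorems.LeeYangTelegraphString

open Literature.Probability.LatticeModels

/-- The pair energy of the one-sided nearest-neighbour couplings is the bond sum
`Σ_{i<k} K_i s_i s_{i+1}`. -/
theorem chainMarkovPlain_isingPairEnergy (K : ℕ → ℝ) (k : ℕ) (s : Fin (k + 1) → Bool) :
    isingPairEnergy (fun i j : Fin (k + 1) => if i.1 + 1 = j.1 then K i else 0) s =
      ∑ i : Fin k, K i * spinVal s i.castSucc * spinVal s i.succ := by
  simp only [isingPairEnergy]
  rw [Finset.sum_comm, Fin.sum_univ_succ]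
  have h0 : ∑ i : Fin (k + 1), (if i.1 + 1 = (0 : Fin (k + 1)).1 then K i else 0) *
      spinVal s i * spinVal s 0 = 0 := by
    refine Finset.sum_eq_zero fun i _ => ?_
    rw [if_neg (by simp), zero_mul, zero_mul]
  rw [h0, zero_add]
  refine Finset.sum_congr rfl fun j _ => ?_
  rw [Finset.sum_eq_single (Fin.castSucc j)]
  · simp
  · intro i _ hi
    rw [if_neg, zero_mul, zero_mul]
    intro h'
    apply hi
    ext
    simp only [Fin.val_succ, Fin.val_castSucc] at h' ⊢
    omega
  · simp

/-- Adding a spin adds one bond. -/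
theorem chainMarkovPlain_isingPairEnergy_snoc (K : ℕ → ℝ) (k : ℕ) (s : Fin (k + 1) → Bool)
    (b : Bool) :
    isingPairEnergy (fun i j : Fin (k + 1 + 1) => if i.1 + 1 = j.1 then K i else 0) (Fin.snoc s b) =
      isingPairEnergy (fun i j : Fin (k + 1) => if i.1 + 1 = j.1 then K i else 0) s +
        K k * spinVal s (Fin.last k) * (if b then 1 else -1) := by
  rw [chainMarkovPlain_isingPairEnergy, chainMarkovPlain_isingPairEnergy, Fin.sum_univ_castSucc]
  simp only [spinVal, Fin.val_castSucc, Fin.snoc_castSucc, Fin.succ_castSucc, Fin.val_last,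
    Fin.succ_last, Fin.snoc_last]

/-- Adding a spin adds one weight. -/
theorem chainMarkovPlain_weightedMagnetization_snoc (P ℓ : ℕ → ℝ) (k : ℕ)
    (s : Fin (k + 1) → Bool) (b : Bool) :
    weightedMagnetization (fun i : Fin (k + 1 + 1) => P i * ℓ i) (Fin.snoc s b) =
      weightedMagnetization (fun i : Fin (k + 1) => P i * ℓ i) s +
        P (k + 1) * ℓ (k + 1) * (if b then 1 else -1) := by
  unfold weightedMagnetization spinVal
  rw [Fin.sum_univ_castSucc]
  simp only [Fin.val_castSucc, Fin.snoc_castSucc, Fin.val_last, Fin.snoc_last]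

/-- Summing over configurations of `k + 1` spins = summing over the last spin and the rest. -/
theorem chainMarkovPlain_sum_config_snoc (k : ℕ) (G : (Fin (k + 1) → Bool) → ℂ) :
    ∑ s, G s = ∑ b : Bool, ∑ t : Fin k → Bool, G (Fin.snoc t b) := by
  rw [← (Fin.snocEquiv fun _ => Bool).sum_comp, Fintype.sum_prod_type]
  rfl

/-- `e^{K σ τ} = cosh K + σ τ sinh K` for spins `σ, τ = ±1`. -/
theorem chainMarkovPlain_exp_coupling (K : ℝ) {n : ℕ} (s : Fin n → Bool) (i : Fin n) (b : Bool) :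
    Real.exp (K * spinVal s i * (if b then (1 : ℝ) else -1)) =
      Real.cosh K + spinVal s i * (if b then (1 : ℝ) else -1) * Real.sinh K := by
  unfold spinVal
  rw [Real.cosh_eq, Real.sinh_eq]
  cases s i <;> cases b <;> simp <;> ring

/-- Peeling the last spin off the Gibbs–Laplace summand `e^{E(s)} e^{h M(s)}`. -/
theorem chainMarkovPlain_summand_snoc (K P ℓ : ℕ → ℝ) (h : ℂ) (k : ℕ) (s : Fin (k + 1) → Bool)
    (b : Bool) :
    (isingBoltzmann (fun i j : Fin (k + 1 + 1) => if i.1 + 1 = j.1 then K i else 0)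
          (Fin.snoc s b) : ℂ) *
        cexp (h * (weightedMagnetization (fun i : Fin (k + 1 + 1) => P i * ℓ i)
          (Fin.snoc s b) : ℂ)) =
      (isingBoltzmann (fun i j : Fin (k + 1) => if i.1 + 1 = j.1 then K i else 0) s : ℂ) *
          cexp (h * (weightedMagnetization (fun i : Fin (k + 1) => P i * ℓ i) s : ℂ)) *
        ((Real.cosh (K k) + spinVal s (Fin.last k) * (if b then 1 else -1) * Real.sinh (K k) :
          ℝ) : ℂ) *
        cexp (h * ((P (k + 1) * ℓ (k + 1) * (if b then 1 else -1) : ℝ) : ℂ)) := by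
  simp only [isingBoltzmann]
  rw [chainMarkovPlain_isingPairEnergy_snoc, chainMarkovPlain_weightedMagnetization_snoc,
    Real.exp_add, chainMarkovPlain_exp_coupling, Complex.ofReal_add, mul_add h, Complex.exp_add,
    Complex.ofReal_mul]
  ring

/-- **One transfer step**: the sum over the first `k + 1` spins with the new last spin `b` fixed,
in terms of `Z_k` (the field partition function) and `B_k` (the sum weighted by the last spin). -/
theorem chainMarkovPlain_sum_summand_snoc (K P ℓ : ℕ → ℝ) (h : ℂ) (k : ℕ) (b : Bool) :
    ∑ s : Fin (k + 1) → Bool,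
        (isingBoltzmann (fun i j : Fin (k + 1 + 1) => if i.1 + 1 = j.1 then K i else 0)
            (Fin.snoc s b) : ℂ) *
          cexp (h * (weightedMagnetization (fun i : Fin (k + 1 + 1) => P i * ℓ i)
            (Fin.snoc s b) : ℂ)) =
      cexp (h * ((P (k + 1) * ℓ (k + 1) * (if b then 1 else -1) : ℝ) : ℂ)) *
        ((Real.cosh (K k) : ℂ) *
            isingFieldPartition (fun i j : Fin (k + 1) => if i.1 + 1 = j.1 then K i else 0)
              (fun i : Fin (k + 1) => P i * ℓ i) h +
          ((if b then 1 else -1 : ℝ) : ℂ) * (Real.sinh (K k) : ℂ) *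
            (∑ s : Fin (k + 1) → Bool,
              (isingBoltzmann (fun i j : Fin (k + 1) => if i.1 + 1 = j.1 then K i else 0) s : ℂ) *
                  cexp (h * (weightedMagnetization (fun i : Fin (k + 1) => P i * ℓ i) s : ℂ)) *
                ((if s (Fin.last k) = true then (1 : ℝ) else -1 : ℝ) : ℂ))) := by
  unfold isingFieldPartition
  rw [Finset.mul_sum, Finset.mul_sum, mul_add, Finset.mul_sum, Finset.mul_sum,
    ← Finset.sum_add_distrib]
  refine Finset.sum_congr rfl fun s _ => ?_
  rw [chainMarkovPlain_summand_snoc]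
  simp only [spinVal]
  push_cast
  ring

/-- Transfer recursion `Z_{k+1} = 2 (cosh(h w_{k+1}) ch K_k Z_k + sinh(h w_{k+1}) sh K_k B_k)`. -/
theorem chainMarkovPlain_partition_succ (K P ℓ : ℕ → ℝ) (h : ℂ) (k : ℕ) :
    isingFieldPartition (fun i j : Fin (k + 1 + 1) => if i.1 + 1 = j.1 then K i else 0)
        (fun i : Fin (k + 1 + 1) => P i * ℓ i) h =
      2 * (Complex.cosh (h * ((P (k + 1) * ℓ (k + 1) : ℝ) : ℂ)) * (Real.cosh (K k) : ℂ) *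
          isingFieldPartition (fun i j : Fin (k + 1) => if i.1 + 1 = j.1 then K i else 0)
            (fun i : Fin (k + 1) => P i * ℓ i) h +
        Complex.sinh (h * ((P (k + 1) * ℓ (k + 1) : ℝ) : ℂ)) * (Real.sinh (K k) : ℂ) *
          (∑ s : Fin (k + 1) → Bool,
            (isingBoltzmann (fun i j : Fin (k + 1) => if i.1 + 1 = j.1 then K i else 0) s : ℂ) *
                cexp (h * (weightedMagnetization (fun i : Fin (k + 1) => P i * ℓ i) s : ℂ)) *
              ((if s (Fin.last k) = true then (1 : ℝ) else -1 : ℝ) : ℂ))) := by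
  conv_lhs => unfold isingFieldPartition
  rw [chainMarkovPlain_sum_config_snoc]
  simp only [chainMarkovPlain_sum_summand_snoc, Fintype.sum_bool, Bool.false_eq_true, if_true,
    if_false, mul_one, Complex.ofReal_neg, Complex.ofReal_one, mul_neg, Complex.cosh, Complex.sinh]
  ring

/-- Transfer recursion `B_{k+1} = 2 (sinh(h w_{k+1}) ch K_k Z_k + cosh(h w_{k+1}) sh K_k B_k)`. -/
theorem chainMarkovPlain_lastSpin_succ (K P ℓ : ℕ → ℝ) (h : ℂ) (k : ℕ) :
    (∑ s : Fin (k + 1 + 1) → Bool,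
      (isingBoltzmann (fun i j : Fin (k + 1 + 1) => if i.1 + 1 = j.1 then K i else 0) s : ℂ) *
          cexp (h * (weightedMagnetization (fun i : Fin (k + 1 + 1) => P i * ℓ i) s : ℂ)) *
        ((if s (Fin.last (k + 1)) = true then (1 : ℝ) else -1 : ℝ) : ℂ)) =
      2 * (Complex.sinh (h * ((P (k + 1) * ℓ (k + 1) : ℝ) : ℂ)) * (Real.cosh (K k) : ℂ) *
          isingFieldPartition (fun i j : Fin (k + 1) => if i.1 + 1 = j.1 then K i else 0)
            (fun i : Fin (k + 1) => P i * ℓ i) h +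
        Complex.cosh (h * ((P (k + 1) * ℓ (k + 1) : ℝ) : ℂ)) * (Real.sinh (K k) : ℂ) *
          (∑ s : Fin (k + 1) → Bool,
            (isingBoltzmann (fun i j : Fin (k + 1) => if i.1 + 1 = j.1 then K i else 0) s : ℂ) *
                cexp (h * (weightedMagnetization (fun i : Fin (k + 1) => P i * ℓ i) s : ℂ)) *
              ((if s (Fin.last k) = true then (1 : ℝ) else -1 : ℝ) : ℂ))) := by
  rw [chainMarkovPlain_sum_config_snoc]
  simp only [Fin.snoc_last, ← Finset.sum_mul, chainMarkovPlain_sum_summand_snoc, Fintype.sum_bool,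
    Bool.false_eq_true, if_true, if_false, mul_one, Complex.ofReal_neg, Complex.ofReal_one,
    mul_neg, Complex.cosh, Complex.sinh]
  ring

/-- `Z_0 = 2 cosh(h w_0)`. -/
theorem chainMarkovPlain_partition_zero (K P ℓ : ℕ → ℝ) (h : ℂ) :
    isingFieldPartition (fun i j : Fin (0 + 1) => if i.1 + 1 = j.1 then K i else 0)
        (fun i : Fin (0 + 1) => P i * ℓ i) h = 2 * Complex.cosh (h * ((P 0 * ℓ 0 : ℝ) : ℂ)) := by
  unfold isingFieldPartition
  rw [chainMarkovPlain_sum_config_snoc, Fintype.sum_bool, Fintype.sum_unique, Fintype.sum_unique]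
  simp only [isingBoltzmann, chainMarkovPlain_isingPairEnergy, Finset.univ_eq_empty,
    Finset.sum_empty, Real.exp_zero, Complex.ofReal_one, one_mul, weightedMagnetization, spinVal,
    Fin.sum_univ_castSucc, Fin.snoc_last, zero_add, Fin.val_last, Bool.false_eq_true, if_true,
    if_false, mul_one, Complex.ofReal_neg, mul_neg, Complex.cosh]
  ring

/-- `B_0 = 2 sinh(h w_0)`. -/
theorem chainMarkovPlain_lastSpin_zero (K P ℓ : ℕ → ℝ) (h : ℂ) :
    (∑ s : Fin (0 + 1) → Bool,
      (isingBoltzmann (fun i j : Fin (0 + 1) => if i.1 + 1 = j.1 then K i else 0) s : ℂ) *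
          cexp (h * (weightedMagnetization (fun i : Fin (0 + 1) => P i * ℓ i) s : ℂ)) *
        ((if s (Fin.last 0) = true then (1 : ℝ) else -1 : ℝ) : ℂ)) =
      2 * Complex.sinh (h * ((P 0 * ℓ 0 : ℝ) : ℂ)) := by
  rw [chainMarkovPlain_sum_config_snoc, Fintype.sum_bool, Fintype.sum_unique, Fintype.sum_unique]
  simp only [isingBoltzmann, chainMarkovPlain_isingPairEnergy, Finset.univ_eq_empty,
    Finset.sum_empty, Real.exp_zero, Complex.ofReal_one, one_mul, weightedMagnetization, spinVal,
    Fin.sum_univ_castSucc, Fin.snoc_last, zero_add, Fin.val_last, Bool.false_eq_true, if_true,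
    if_false, mul_one, Complex.ofReal_neg, mul_neg, Complex.sinh]
  ring

/-- The transfer product of the one-piece chain is the transfer matrix `M_0`. -/
theorem chainMarkovPlain_transfer_zero (P ℓ : ℕ → ℝ) (h : ℂ) :
    (List.ofFn fun j : Fin (0 + 1) =>
        !![Complex.cosh (h * ((P j * ℓ j : ℝ) : ℂ)),
            h * (P j : ℂ) * Complex.sinh (h * ((P j * ℓ j : ℝ) : ℂ));
          Complex.sinh (h * ((P j * ℓ j : ℝ) : ℂ)) / (h * (P j : ℂ)),
            Complex.cosh (h * ((P j * ℓ j : ℝ) : ℂ))]).prod =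
      !![Complex.cosh (h * ((P 0 * ℓ 0 : ℝ) : ℂ)),
          h * (P 0 : ℂ) * Complex.sinh (h * ((P 0 * ℓ 0 : ℝ) : ℂ));
        Complex.sinh (h * ((P 0 * ℓ 0 : ℝ) : ℂ)) / (h * (P 0 : ℂ)),
          Complex.cosh (h * ((P 0 * ℓ 0 : ℝ) : ℂ))] := by
  simp [List.ofFn_succ]

/-- The transfer product of the chain `0..k+1` is that of `0..k` times `M_{k+1}`. -/
theorem chainMarkovPlain_transfer_succ (P ℓ : ℕ → ℝ) (h : ℂ) (k : ℕ) :
    (List.ofFn fun j : Fin (k + 1 + 1) =>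
        !![Complex.cosh (h * ((P j * ℓ j : ℝ) : ℂ)),
            h * (P j : ℂ) * Complex.sinh (h * ((P j * ℓ j : ℝ) : ℂ));
          Complex.sinh (h * ((P j * ℓ j : ℝ) : ℂ)) / (h * (P j : ℂ)),
            Complex.cosh (h * ((P j * ℓ j : ℝ) : ℂ))]).prod =
      (List.ofFn fun j : Fin (k + 1) =>
          !![Complex.cosh (h * ((P j * ℓ j : ℝ) : ℂ)),
              h * (P j : ℂ) * Complex.sinh (h * ((P j * ℓ j : ℝ) : ℂ));
            Complex.sinh (h * ((P j * ℓ j : ℝ) : ℂ)) / (h * (P j : ℂ)),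
              Complex.cosh (h * ((P j * ℓ j : ℝ) : ℂ))]).prod *
        !![Complex.cosh (h * ((P (k + 1) * ℓ (k + 1) : ℝ) : ℂ)),
            h * (P (k + 1) : ℂ) * Complex.sinh (h * ((P (k + 1) * ℓ (k + 1) : ℝ) : ℂ));
          Complex.sinh (h * ((P (k + 1) * ℓ (k + 1) : ℝ) : ℂ)) / (h * (P (k + 1) : ℂ)),
            Complex.cosh (h * ((P (k + 1) * ℓ (k + 1) : ℝ) : ℂ))] := by
  rw [List.ofFn_succ', List.concat_eq_append, List.prod_append, List.prod_singleton]
  rfl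

/-- At `h = 0` the transfer product is the identity: every factor is (Lean's `x / 0 = 0`). -/
theorem chainMarkovPlain_transfer_zero_field (P ℓ : ℕ → ℝ) (k : ℕ) :
    (List.ofFn fun j : Fin (k + 1) =>
        !![Complex.cosh ((0 : ℂ) * ((P j * ℓ j : ℝ) : ℂ)),
            (0 : ℂ) * (P j : ℂ) * Complex.sinh ((0 : ℂ) * ((P j * ℓ j : ℝ) : ℂ));
          Complex.sinh ((0 : ℂ) * ((P j * ℓ j : ℝ) : ℂ)) / ((0 : ℂ) * (P j : ℂ)),
            Complex.cosh ((0 : ℂ) * ((P j * ℓ j : ℝ) : ℂ))]).prod = 1 := by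
  refine List.prod_eq_one fun x hx => ?_
  obtain ⟨i, rfl⟩ := List.mem_ofFn.1 hx
  rw [Matrix.one_fin_two]
  simp

/-- **Transfer invariant**: `(M_0 ⋯ M_k)₀₀ c_k = Z_k` and `(M_0 ⋯ M_k)₀₁ c_k = h P_k B_k` for a
constant `c_k` independent of the field `h`, as long as `tanh K_i = P_i / P_{i+1}` along it. -/
theorem chainMarkovPlain_transfer_invariant (N : ℕ) (P ℓ K : ℕ → ℝ) (hP : ∀ i, i < N → P i ≠ 0)
    (hK : ∀ i, i + 1 < N → Real.sinh (K i) * P (i + 1) = Real.cosh (K i) * P i) :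
    ∀ k, k < N → ∃ c : ℂ, ∀ h : ℂ,
      (List.ofFn fun j : Fin (k + 1) =>
          !![Complex.cosh (h * ((P j * ℓ j : ℝ) : ℂ)),
              h * (P j : ℂ) * Complex.sinh (h * ((P j * ℓ j : ℝ) : ℂ));
            Complex.sinh (h * ((P j * ℓ j : ℝ) : ℂ)) / (h * (P j : ℂ)),
              Complex.cosh (h * ((P j * ℓ j : ℝ) : ℂ))]).prod 0 0 * c =
        isingFieldPartition (fun i j : Fin (k + 1) => if i.1 + 1 = j.1 then K i else 0)
          (fun i : Fin (k + 1) => P i * ℓ i) h ∧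
      (List.ofFn fun j : Fin (k + 1) =>
          !![Complex.cosh (h * ((P j * ℓ j : ℝ) : ℂ)),
              h * (P j : ℂ) * Complex.sinh (h * ((P j * ℓ j : ℝ) : ℂ));
            Complex.sinh (h * ((P j * ℓ j : ℝ) : ℂ)) / (h * (P j : ℂ)),
              Complex.cosh (h * ((P j * ℓ j : ℝ) : ℂ))]).prod 0 1 * c =
        h * (P k : ℂ) *
          (∑ s : Fin (k + 1) → Bool,
            (isingBoltzmann (fun i j : Fin (k + 1) => if i.1 + 1 = j.1 then K i else 0) s : ℂ) *
                cexp (h * (weightedMagnetization (fun i : Fin (k + 1) => P i * ℓ i) s : ℂ)) *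
              ((if s (Fin.last k) = true then (1 : ℝ) else -1 : ℝ) : ℂ)) := by
  intro k
  induction k with
  | zero =>
      intro _
      refine ⟨2, fun h => ?_⟩
      rw [chainMarkovPlain_transfer_zero, chainMarkovPlain_partition_zero,
        chainMarkovPlain_lastSpin_zero]
      simp only [Matrix.of_apply, Matrix.cons_val', Matrix.cons_val_zero, Matrix.cons_val_one,
        Matrix.cons_val_fin_one]
      constructor <;> ring
  | succ k IH =>
      intro hk
      obtain ⟨c, hc⟩ := IH (by omega)
      refine ⟨c * (2 * (Real.cosh (K k) : ℂ)), fun h => ?_⟩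
      obtain ⟨h1, h2⟩ := hc h
      obtain ⟨B, hB⟩ : ∃ B : ℂ, B = ∑ s : Fin (k + 1) → Bool,
          (isingBoltzmann (fun i j : Fin (k + 1) => if i.1 + 1 = j.1 then K i else 0) s : ℂ) *
              cexp (h * (weightedMagnetization (fun i : Fin (k + 1) => P i * ℓ i) s : ℂ)) *
            ((if s (Fin.last k) = true then (1 : ℝ) else -1 : ℝ) : ℂ) := ⟨_, rfl⟩
      rw [← hB] at h2
      have htanh : (Real.sinh (K k) : ℂ) * (P (k + 1) : ℂ) = (Real.cosh (K k) : ℂ) * (P k : ℂ) := by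
        exact_mod_cast hK k hk
      have hS : Complex.sinh (h * ((P (k + 1) * ℓ (k + 1) : ℝ) : ℂ)) *
          (h * (P (k + 1) : ℂ) * (h * (P (k + 1) : ℂ))⁻¹) =
            Complex.sinh (h * ((P (k + 1) * ℓ (k + 1) : ℝ) : ℂ)) := by
        rcases eq_or_ne h 0 with rfl | hh
        · simp
        · rw [mul_inv_cancel₀ (mul_ne_zero hh (by exact_mod_cast hP (k + 1) hk)), mul_one]
      rw [chainMarkovPlain_transfer_succ, Matrix.mul_apply, Matrix.mul_apply, Fin.sum_univ_two,
        Fin.sum_univ_two, chainMarkovPlain_partition_succ, chainMarkovPlain_lastSpin_succ, ← hB]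
      simp only [Matrix.of_apply, Matrix.cons_val', Matrix.cons_val_zero, Matrix.cons_val_one,
        Matrix.cons_val_fin_one]
      rw [div_eq_mul_inv]
      constructor
      · linear_combination (2 * (Real.cosh (K k) : ℂ) *
            Complex.cosh (h * ((P (k + 1) * ℓ (k + 1) : ℝ) : ℂ))) * h1 +
          (2 * (Real.cosh (K k) : ℂ) * Complex.sinh (h * ((P (k + 1) * ℓ (k + 1) : ℝ) : ℂ)) *
            (h * (P (k + 1) : ℂ))⁻¹) * h2 +
          (-(2 * Complex.sinh (h * ((P (k + 1) * ℓ (k + 1) : ℝ) : ℂ)) * B * h *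
            (h * (P (k + 1) : ℂ))⁻¹)) * htanh +
          (2 * B * (Real.sinh (K k) : ℂ)) * hS
      · linear_combination (2 * (Real.cosh (K k) : ℂ) * h * (P (k + 1) : ℂ) *
            Complex.sinh (h * ((P (k + 1) * ℓ (k + 1) : ℝ) : ℂ))) * h1 +
          (2 * (Real.cosh (K k) : ℂ) * Complex.cosh (h * ((P (k + 1) * ℓ (k + 1) : ℝ) : ℂ))) * h2 +
          (-(2 * Complex.cosh (h * ((P (k + 1) * ℓ (k + 1) : ℝ) : ℂ)) * h * B)) * htanh

/-- `tanh (arsinh (p / √(p'² - p²))) = p / p'` for `0 < p < p'`, in product form. -/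
theorem chainMarkovPlain_sinh_arsinh_coupling {p p' : ℝ} (hp : 0 < p) (hpp : p < p') :
    Real.cosh (Real.arsinh (p / Real.sqrt (p' ^ 2 - p ^ 2))) * p =
      Real.sinh (Real.arsinh (p / Real.sqrt (p' ^ 2 - p ^ 2))) * p' := by
  rw [Real.sinh_arsinh, Real.cosh_arsinh]
  have hd : 0 < p' ^ 2 - p ^ 2 := by nlinarith
  have hs : 0 < Real.sqrt (p' ^ 2 - p ^ 2) := Real.sqrt_pos.2 hd
  have h1 : 1 + (p / Real.sqrt (p' ^ 2 - p ^ 2)) ^ 2 = (p' / Real.sqrt (p' ^ 2 - p ^ 2)) ^ 2 := by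
    rw [div_pow, div_pow, Real.sq_sqrt hd.le]
    field_simp
    ring
  rw [h1, Real.sqrt_sq (div_nonneg (hp.le.trans hpp.le) hs.le)]
  ring

/-- **Stub chainMarkovPlain — Ising side of the dictionary** (twin of `stub_chainMarkov`).
For step data (`ℓ_j ≥ 0`, `0 < P_0 < P_1 < …`) the nearest-neighbour chain with weights
`w_j = P_j ℓ_j` and bond couplings `K_j = arsinh (P_j / √(P_{j+1}² - P_j²)) ≥ 0` (so
`tanh K_j = P_j / P_{j+1}`; `J_{j,j+1} = K_j`, all other `J = 0`) is a finite ferromagnet whose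
Laplace transform is the transfer product `TP(ℓ, P; h)`. -/
theorem stub_chainMarkovPlain : ∀ (N : ℕ) (ℓ P : Fin N → ℝ), (∀ j, 0 ≤ ℓ j) → (∀ j, 0 < P j) →
    StrictMono P →
    ∃ (n : ℕ) (J : Fin n → Fin n → ℝ) (w : Fin n → ℝ), (∀ i j, 0 ≤ J i j) ∧ (∀ i, 0 ≤ w i) ∧
      ∀ (h : ℂ), ∫ u, cexp (h * u) ∂(isingMagnetizationLaw n J w : Measure ℝ) =
        (List.ofFn fun j : Fin N =>
          !![Complex.cosh (h * ((P j * ℓ j : ℝ) : ℂ)),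
              h * (P j : ℂ) * Complex.sinh (h * ((P j * ℓ j : ℝ) : ℂ));
            Complex.sinh (h * ((P j * ℓ j : ℝ) : ℂ)) / (h * (P j : ℂ)),
              Complex.cosh (h * ((P j * ℓ j : ℝ) : ℂ))]).prod 0 0 := by
  intro N ℓ P hℓ hP hmono
  obtain _ | k := N
  · refine ⟨0, fun _ _ => 0, fun _ => 0, fun _ _ => le_rfl, fun _ => le_rfl, fun h => ?_⟩
    rw [integral_exp_isingMagnetizationLaw]
    simp [isingFieldPartition, isingPairPartition, isingBoltzmann, isingPairEnergy,
      weightedMagnetization]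
  · obtain ⟨P', hP'⟩ : ∃ P' : ℕ → ℝ, ∀ j : Fin (k + 1), P' j = P j :=
      ⟨fun i => if hi : i < k + 1 then P ⟨i, hi⟩ else 0, fun j => dif_pos j.isLt⟩
    obtain ⟨ℓ', hℓ'⟩ : ∃ ℓ' : ℕ → ℝ, ∀ j : Fin (k + 1), ℓ' j = ℓ j :=
      ⟨fun i => if hi : i < k + 1 then ℓ ⟨i, hi⟩ else 0, fun j => dif_pos j.isLt⟩
    have hPpos : ∀ i (hi : i < k + 1), 0 < P' i := fun i hi => by
      rw [show (i : ℕ) = ((⟨i, hi⟩ : Fin (k + 1)) : ℕ) from rfl, hP']; exact hP _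
    have hPne : ∀ i, i < k + 1 → P' i ≠ 0 := fun i hi => (hPpos i hi).ne'
    have hPlt : ∀ i (hi : i + 1 < k + 1), P' i < P' (i + 1) := fun i hi => by
      have hi' : i < k + 1 := by omega
      rw [show (i : ℕ) = ((⟨i, hi'⟩ : Fin (k + 1)) : ℕ) from rfl, hP',
        show (i + 1 : ℕ) = ((⟨i + 1, hi⟩ : Fin (k + 1)) : ℕ) from rfl, hP']
      exact hmono (Fin.mk_lt_mk.2 (Nat.lt_succ_self i))
    obtain ⟨K, hK0, hK⟩ : ∃ K : ℕ → ℝ, (∀ i, 0 ≤ K i) ∧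
        ∀ i, i + 1 < k + 1 → Real.sinh (K i) * P' (i + 1) = Real.cosh (K i) * P' i := by
      refine ⟨fun i => if i + 1 < k + 1 then
        Real.arsinh (P' i / Real.sqrt (P' (i + 1) ^ 2 - P' i ^ 2)) else 0, fun i => ?_,
        fun i hi => ?_⟩
      · dsimp only
        split_ifs with hi
        · exact Real.arsinh_nonneg_iff.2
            (div_nonneg (hPpos i (by omega)).le (Real.sqrt_nonneg _))
        · exact le_rfl
      · dsimp only
        rw [if_pos hi]
        exact (chainMarkovPlain_sinh_arsinh_coupling (hPpos i (by omega)) (hPlt i hi)).symm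
    refine ⟨k + 1, fun i j : Fin (k + 1) => if i.1 + 1 = j.1 then K i else 0,
      fun i : Fin (k + 1) => P' i * ℓ' i, ?_, ?_, ?_⟩
    · intro i j
      dsimp only
      split_ifs
      · exact hK0 _
      · exact le_rfl
    · intro i
      show 0 ≤ P' i * ℓ' i
      rw [hP', hℓ']
      exact mul_nonneg (hP _).le (hℓ _)
    · intro h
      obtain ⟨c, hc⟩ := chainMarkovPlain_transfer_invariant (k + 1) P' ℓ' K hPne hK k (lt_add_one k)
      have h0 := (hc 0).1
      rw [chainMarkovPlain_transfer_zero_field, Matrix.one_apply_eq, one_mul,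
        isingFieldPartition_zero] at h0
      have hc0 : c ≠ 0 := by rw [h0]; exact_mod_cast (isingPairPartition_pos _).ne'
      rw [integral_exp_isingMagnetizationLaw, ← h0, ← (hc h).1, mul_div_assoc, div_self hc0,
        mul_one]
      simp only [hP', hℓ']

end Summit.RiemannHypothesis.RiemannHypothesis.Theorems.LeeYangTelegraphString
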